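import Literature.AlgebraicGeometry.Resolution.Kuhlmann2019Lemma42PElimination
import Literature.AlgebraicGeometry.Resolution.Kuhlmann2019Lemma42Center
import Literature.AlgebraicGeometry.Resolution.KnafKuhlmann2009Lemma216
import Literature.AlgebraicGeometry.Resolution.Kuhlmann2019DegreePStepAssembly
import HarnessLib

/-!
# Kuhlmann 2019, Lemma 4.2 (the Artin–Schreier normal form) over a separably closed field — `(H42)` proved; Prop. 4.8 unconditional

Topic: `Literature/AlgebraicGeometry/Resolution` (valued function fields). This file PROVES the
hypothesis `(H42)` of `Kuhlmann2019DegreePStepAssembly.lean` — the part of F.-V. Kuhlmann,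
*Elimination of ramification II: Henselian rationality*, Israel J. Math. 234 (2019) =
arXiv:1701.05508, **Lemma 4.2**, used in the proof of Prop. 4.8 — for the separably closed
ground fields of Prop. 5.2, assembling

* the elimination of the `p`-divisible indices modulo `℘(K(z)^h)` with control of the values
  of the new coefficients (`exists_pElimination`, `Kuhlmann2019Lemma42PElimination.lean`;
  (4.7)–(4.9) of the printed proof together with its last paragraph, the density of `K` in its
  perfect hull),
* the choice of the centre `c` and the scale `d` by the transcendental approximation type
  (`exists_center_valuation_pow_ne`, `Kuhlmann2019Lemma42Center.lean`; (4.10)–(4.11)), the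
  approximation type being transcendental over a separably closed `K` by Knaf–Kuhlmann 2009,
  Lemma 2.16 (`kaplansky_condition_of_isSepClosed`; Lemma 4.6 of the source),
* the Taylor expansion (4.7) at `c` in the variable `z̃ = (z − c)/d` (Mathlib's `taylor`,
  `hasseDeriv`),

so that Prop. 4.8 (`prop48_of_normalForm`) becomes unconditional for separably closed `K` of
rank one (`prop48_sepClosed`), and the named fact `Kuhlmann2019_Prop52_sepClosed` is reduced
to the two remaining printed statements `(H43)` (Lemma 4.3, the Kummer normal form in mixed
characteristic) and `(hKV)` ([23, Thm. 11.1]): `Kuhlmann2019_Prop52_sepClosed.of_normalForm43`.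

Printed statement being established (Lemma 4.2 with `K′ = K`, in the form consumed by the
proof of Prop. 4.8; see the module docstring of `Kuhlmann2019DegreePStepAssembly.lean`): for
`z` transcendental over `K` with `(K(z)|K, v)` immediate and a polynomial `f` over `K` there
are `c ∈ K`, `0 ≠ d ∈ K` with `v(z̃) = 0`, `z̃ = (z − c)/d`, a polynomial `g` over `K` and
`e ∈ K(z)^h` with `f(z) − g(z̃) = e^p − e`, all non-zero coefficients `gᵢ`, `i > 0`, having
`p ∤ i` and pairwise distinct values.

## Content (everything PROVED; no definition, no named fact)

* `coeff_mem_of_mem_lifts`, `mem_lifts_of_coeff_mem` — polynomials over `K` as the subsemiring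
  `Polynomial.lifts`; `exists_valuation_lt_one_of_immediate` — an immediate `K(z) ∋ z ∉ K`
  forces `v` to be non-trivial on `K`.
* `lemma42_normalForm` — **`(H42)`**. The values of the exact coefficients are compared through
  `S_j^{p^D} = d^{jp^D} · P_j(c)` with the polynomials `P_j = ∑_{i ∈ fibre(j)} (f^{[i]})^{p^{D−ν(i)}}`
  over `K` (`pRootSum_pow`, the device (4.9)).
* `prop48_sepClosed` — **Kuhlmann 2019, Prop. 4.8 for separably closed `K` of rank one**,
  unconditionally.
* `Kuhlmann2019_Prop52_sepClosed.of_normalForm43` — **Prop. 5.2 from `(H43)` and `(hKV)`**.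

## Sources

* [K19] F.-V. Kuhlmann, Israel J. Math. 234 (2019) = arXiv:1701.05508: Lemma 4.2 (p. 8),
  Lemma 4.6, Prop. 4.8 (p. 11), Prop. 5.2 (p. 12). [Kuhlmann2019]
* [KK09] H. Knaf, F.-V. Kuhlmann, Adv. Math. 221 (2009): Lemmas 2.5, 2.16–2.18. [KnafKuhlmann2009]

## Rendering notes

As in `Kuhlmann2019DegreePStepAssembly.lean` and `Kuhlmann2019Lemma42PElimination.lean`.
-/

noncomputable section

namespace Literature.AlgebraicGeometry.Resolution

universe u

open Polynomial IsLocalRing IntermediateField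

variable {Ω : Type u} [Field Ω] (V : ValuationSubring Ω)

section NormalForm

variable {p : ℕ} [Fact p.Prime] [CharP Ω p]

omit V in
/-- Polynomials over `K` (coefficients in `K`) are closed under the ring operations: the
subsemiring `Polynomial.lifts` of the inclusion. [folklore] -/
theorem coeff_mem_of_mem_lifts {K : Subfield Ω} {P : Polynomial Ω}
    (hP : P ∈ Polynomial.lifts (algebraMap K Ω)) (k : ℕ) : P.coeff k ∈ K := by
  obtain ⟨c, hc⟩ := (Polynomial.lifts_iff_coeff_lifts P).mp hP k
  rw [← hc]
  exact c.2

omit V in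
/-- A polynomial with coefficients in `K` lies in `Polynomial.lifts`. [folklore] -/
theorem mem_lifts_of_coeff_mem {K : Subfield Ω} {P : Polynomial Ω} (hP : ∀ k, P.coeff k ∈ K) :
    P ∈ Polynomial.lifts (algebraMap K Ω) :=
  (Polynomial.lifts_iff_coeff_lifts P).mpr fun k => ⟨⟨P.coeff k, hP k⟩, rfl⟩

/-- **An immediate `K(z) ∋ z ∉ K` forces the valuation to be non-trivial on `K`.** [folklore] -/
theorem exists_valuation_lt_one_of_immediate {K : Subfield Ω} {z : Ω} (hzK : z ∉ K)
    (hval : ∀ w ∈ Subfield.closure ((K : Set Ω) ∪ {z}), w ≠ 0 → ∃ b ∈ K,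
      V.valuation w = V.valuation b)
    (hres : ∀ w ∈ Subfield.closure ((K : Set Ω) ∪ {z}), w ∈ V → ∃ c ∈ K,
      V.valuation (w - c) < 1) :
    ∃ π ∈ K, π ≠ 0 ∧ V.valuation π < 1 := by
  by_contra hno
  push Not at hno
  have hK1 : ∀ c ∈ K, c ≠ 0 → V.valuation c = 1 := by
    intro c hc hc0
    have h1 : 1 ≤ V.valuation c := hno c hc hc0
    have h2 : 1 ≤ V.valuation c⁻¹ := hno c⁻¹ (K.inv_mem hc) (inv_ne_zero hc0)
    rw [map_inv₀, one_le_inv_iff₀] at h2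
    exact le_antisymm h2.2 h1
  have hzE : z ∈ Subfield.closure ((K : Set Ω) ∪ {z}) := Subfield.subset_closure (Or.inr rfl)
  -- `v(z) ≤ 1`, so `z ≡ c ∈ K`, and then `z = c`
  have hz1 : V.valuation z ≤ 1 := by
    by_cases hz0 : z = 0
    · rw [hz0, map_zero]; exact zero_le_one
    obtain ⟨b, hbK, hb⟩ := hval z hzE hz0
    have hb0 : b ≠ 0 := by rintro rfl; rw [map_zero, map_eq_zero] at hb; exact hz0 hb
    rw [hb, hK1 b hbK hb0]
  obtain ⟨c, hcK, hc⟩ := hres z hzE ((V.valuation_le_one_iff z).mp hz1)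
  have hzc : z - c = 0 := by
    by_contra hne
    obtain ⟨b, hbK, hb⟩ := hval (z - c) (sub_mem hzE (Subfield.subset_closure (Or.inl hcK))) hne
    have hb0 : b ≠ 0 := by rintro rfl; rw [map_zero, map_eq_zero] at hb; exact hne hb
    rw [hb, hK1 b hbK hb0] at hc
    exact lt_irrefl _ hc
  exact hzK (by rw [sub_eq_zero.mp hzc]; exact hcK)

/-- **Kuhlmann 2019, Lemma 4.2 over a separably closed `K` — the statement `(H42)`.** For
`K ≤ Ω` separably closed (inside the algebraically closed `(Ω, V)` of characteristic `p`), `z`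
transcendental over `K` with `(K(z)|K, V)` immediate, and a polynomial `f` over `K`: there are
`c ∈ K`, `d ∈ K^×` with `v((z − c)/d) = 1`, a polynomial `g` over `K` and `e ∈ K(z)^h` with
`f(z) − g((z − c)/d) = e^p − e`, such that the non-zero coefficients `gᵢ`, `i > 0`, have `p ∤ i`
and pairwise distinct values. PROVED (module docstring). [cite: Kuhlmann2019, Lemma 4.2] -/
theorem lemma42_normalForm [IsAlgClosed Ω] (K : Subfield Ω) [IsSepClosed K]
    {z : Ω} (hz : Transcendental K z)
    (himm : IsImmediateOver V K (Subfield.closure ((K : Set Ω) ∪ {z})))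
    (f : Polynomial Ω) (hf : ∀ k, f.coeff k ∈ K) :
    ∃ c ∈ K, ∃ d ∈ K, d ≠ 0 ∧ V.valuation ((z - c) / d) = 1 ∧
      ∃ g : Polynomial Ω, (∀ k, g.coeff k ∈ K) ∧
        (∃ e ∈ henselization V (Subfield.closure ((K : Set Ω) ∪ {z})),
          f.eval z - g.eval ((z - c) / d) = e ^ p - e) ∧
        (∀ i, 0 < i → g.coeff i ≠ 0 → ¬ p ∣ i) ∧
        (∀ i j, 0 < i → 0 < j → i ≠ j → g.coeff i ≠ 0 → g.coeff j ≠ 0 →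
          V.valuation (g.coeff i) ≠ V.valuation (g.coeff j)) := by
  classical
  have hp : p.Prime := Fact.out
  set Kz : Subfield Ω := Subfield.closure ((K : Set Ω) ∪ {z}) with hKzdef
  have hKKz : K ≤ Kz := fun c hc => Subfield.subset_closure (Or.inl hc)
  have hzKz : z ∈ Kz := Subfield.subset_closure (Or.inr rfl)
  ---------------------------------------------------------------- immediateness, transcendence
  have htrans : ∀ P : Polynomial Ω, (∀ k, P.coeff k ∈ K) → P.eval z = 0 → P = 0 := by
    intro P hP hPz
    obtain ⟨P', hP'⟩ : ∃ P' : Polynomial K, P'.map (algebraMap K Ω) = P :=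
      (Polynomial.mem_lifts P).mp (mem_lifts_of_coeff_mem hP)
    by_contra hP0
    refine hz ⟨P', fun h => hP0 ?_, ?_⟩
    · rw [← hP', h, Polynomial.map_zero]
    · rw [Polynomial.aeval_def, ← Polynomial.eval_map, hP', hPz]
  have hzK : z ∉ K := not_mem_of_forall_eval_eq_zero K htrans
  have hval : ∀ w ∈ Kz, w ≠ 0 → ∃ b ∈ K, V.valuation w = V.valuation b := himm.1
  have hres : ∀ w ∈ Kz, w ∈ V → ∃ c ∈ K, V.valuation (w - c) < 1 := by
    intro w hw hwV
    have hrw : residue V ⟨w, hwV⟩ ∈ resField V K := himm.2 (residue_mem_resField V ⟨w, hwV⟩ hw)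
    obtain ⟨c, hcK, hcw⟩ := (mem_resField_iff V K _).mp hrw
    refine ⟨c, hcK, ?_⟩
    have h0 : residue V (⟨w, hwV⟩ - c) = 0 := by rw [map_sub, hcw, sub_self]
    exact (ValuationSubring.valuation_lt_one_iff V (⟨w, hwV⟩ - c)).mp ((residue_eq_zero_iff _).mp h0)
  have h3 := kaplansky_condition_of_isSepClosed V K htrans hval hres
  have hnt := exists_valuation_lt_one_of_immediate V hzK hval hres
  ---------------------------------------------------------------- the polynomials `P_j` ((4.9))
  set D : ℕ := f.natDegree with hDdef
  set Pj : ℕ → Polynomial Ω := fun j =>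
    ∑ i ∈ pFiber p D j, hasseDeriv i f ^ p ^ (D - i.factorization p) with hPjdef
  have hPjK : ∀ j k, (Pj j).coeff k ∈ K := by
    intro j
    apply coeff_mem_of_mem_lifts
    refine Subsemiring.sum_mem _ fun i _ => Subsemiring.pow_mem _ ?_ _
    exact mem_lifts_of_coeff_mem fun k => coeff_hasseDeriv_mem K hf i k
  set G : Finset (Polynomial Ω) := (pFreeIndices p D).image Pj with hGdef
  have hG : ∀ g ∈ G, ∀ k, g.coeff k ∈ K := by
    intro g hg k
    obtain ⟨j, -, rfl⟩ := Finset.mem_image.mp hg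
    exact hPjK j k
  ---------------------------------------------------------------- the centre `a` and scale `b`
  obtain ⟨a, haK, b, hbK, hb0, hvb, hne⟩ :=
    exists_center_valuation_pow_ne V K hzK hval hres h3 G hG (D * p ^ D)
  set zt : Ω := (z - a) / b with hztdef
  have hvb0 : V.valuation b ≠ 0 := (_root_.map_ne_zero _).mpr hb0
  have hzt1 : V.valuation zt = 1 := by
    rw [hztdef, map_div₀, ← hvb, div_self hvb0]
  have hztKz : zt ∈ Kz := div_mem (sub_mem hzKz (hKKz haK)) (hKKz hbK)
  have hbzt : b * zt = z - a := by rw [hztdef, mul_div_cancel₀ _ hb0]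
  ---------------------------------------------------------------- the polynomial `B` in `z̃`
  set T : ℕ → Ω := fun i => (taylor a f).coeff i with hTdef
  have hTK : ∀ i, T i ∈ K := fun i => coeff_taylor_mem K hf haK i
  have hT : ∀ i, T i = (hasseDeriv i f).eval a := fun i => taylor_coeff _ _ i
  set B : Polynomial Ω := ∑ i ∈ Finset.range (D + 1), C (T i * b ^ i) * X ^ i with hBdef
  have hBcoeff : ∀ k, B.coeff k = if k ∈ Finset.range (D + 1) then T k * b ^ k else 0 := by
    intro k
    rw [hBdef, finsetSum_coeff]
    have h1 : ∀ i ∈ Finset.range (D + 1), (C (T i * b ^ i) * X ^ i).coeff k =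
        if k = i then T i * b ^ i else 0 := by
      intro i _
      rw [coeff_C_mul, coeff_X_pow, mul_ite, mul_one, mul_zero]
    rw [Finset.sum_congr rfl h1, Finset.sum_ite_eq]
  have hB : ∀ k, B.coeff k ∈ K := by
    intro k
    rw [hBcoeff]
    split_ifs
    · exact mul_mem (hTK k) (pow_mem hbK k)
    · exact K.zero_mem
  have hBdeg : B.natDegree ≤ D := by
    rw [natDegree_le_iff_coeff_eq_zero]
    intro k hk
    rw [hBcoeff, if_neg]
    rw [Finset.mem_range]
    omega
  have hBeval : B.eval zt = f.eval z := by
    have h1 : f.eval z = (taylor a f).eval (z - a) := by rw [taylor_eval, sub_add_cancel]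
    have hdegT : (taylor a f).natDegree < D + 1 := by rw [natDegree_taylor]; omega
    rw [h1, eval_eq_sum_range' hdegT, hBdef, eval_finsetSum]
    refine Finset.sum_congr rfl fun i _ => ?_
    rw [eval_mul, eval_C, eval_pow, eval_X, ← hbzt, mul_pow, mul_assoc]
  ---------------------------------------------------------------- elimination in `F = K(z)^h`
  set F : Subfield Ω := henselization V Kz with hFdef
  have hKzF : Kz ≤ F := le_henselization V Kz
  have hFh : IsHenselianField F (V.comap (algebraMap F Ω)) :=
    Kuhlmann2010HenselizationIsHenselian_holds Ω V Kz
  have hF : HenselianLocalRing (V.comap (algebraMap F Ω)) := Kuhlmann2010HenselsLemma_holds _ _ hFh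
  obtain ⟨g, hg, -, ⟨e, heF, hcong⟩, hpdiv, hvals⟩ :=
    exists_pElimination V (hKKz.trans hKzF) hnt hF (hKzF hztKz) hzt1.le hB hBdeg
  ---------------------------------------------------------------- `S_i^{p^D} = b^{i p^D} P_i(a)`
  have hSpow : ∀ i, 0 < i → i ≤ D →
      pRootSum p B D i ^ p ^ D = b ^ (i * p ^ D) * (Pj i).eval a := by
    intro i hi hiD
    rw [pRootSum_pow, hPjdef]
    simp only
    rw [eval_finsetSum, Finset.mul_sum]
    refine Finset.sum_congr rfl fun k hk => ?_
    obtain ⟨⟨hk0, hkD⟩, hki⟩ := mem_pFiber_iff.mp hk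
    have hν : k.factorization p ≤ D := (factorization_le_of_pos hp hk0).trans hkD
    have hkmem : k ∈ Finset.range (D + 1) := Finset.mem_range.mpr (Nat.lt_succ_of_le hkD)
    have hexp : k * p ^ (D - k.factorization p) = i * p ^ D := by
      have h1 := pow_factorization_mul_pFreePart (p := p) k
      rw [hki] at h1
      calc k * p ^ (D - k.factorization p)
          = p ^ k.factorization p * i * p ^ (D - k.factorization p) := by rw [h1]
        _ = i * (p ^ k.factorization p * p ^ (D - k.factorization p)) := by ring
        _ = i * p ^ D := by rw [← pow_add, Nat.add_sub_cancel' hν]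
    rw [hBcoeff, if_pos hkmem, eval_pow, ← hT, mul_pow, ← pow_mul, hexp]
    ring
  ---------------------------------------------------------------- conclusion
  refine ⟨a, haK, b, hbK, hb0, hzt1, g, hg, ⟨e, heF, ?_⟩, ?_, ?_⟩
  · rw [← hBeval]
    exact hcong
  · intro i hi hgi hpi
    exact hgi (hpdiv i hi hpi)
  · intro i j hi hj hij hgi hgj heq
    -- `i, j ≤ D`, prime to `p`, with `S ≠ 0` and `v(g) = v(S)`
    have hpi : ¬ p ∣ i := fun h => hgi (hpdiv i hi h)
    have hpj : ¬ p ∣ j := fun h => hgj (hpdiv j hj h)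
    have hiD : i ≤ D := by
      by_contra hlt
      push Not at hlt
      exact hgi ((hvals i hi hpi).1 (pRootSum_eq_zero_of_lt hlt))
    have hjD : j ≤ D := by
      by_contra hlt
      push Not at hlt
      exact hgj ((hvals j hj hpj).1 (pRootSum_eq_zero_of_lt hlt))
    have hSi : pRootSum p B D i ≠ 0 := fun h0 => hgi ((hvals i hi hpi).1 h0)
    have hSj : pRootSum p B D j ≠ 0 := fun h0 => hgj ((hvals j hj hpj).1 h0)
    have hvi : V.valuation (g.coeff i) = V.valuation (pRootSum p B D i) := (hvals i hi hpi).2 hSi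
    have hvj : V.valuation (g.coeff j) = V.valuation (pRootSum p B D j) := (hvals j hj hpj).2 hSj
    -- `P_i(a), P_j(a) ≠ 0`
    have hPi0 : (Pj i).eval a ≠ 0 := by
      intro h0
      have := hSpow i hi hiD
      rw [h0, mul_zero] at this
      exact pow_ne_zero _ hSi this
    have hPj0 : (Pj j).eval a ≠ 0 := by
      intro h0
      have := hSpow j hj hjD
      rw [h0, mul_zero] at this
      exact pow_ne_zero _ hSj this
    have hPiG : Pj i ∈ G := Finset.mem_image.mpr ⟨i, mem_pFreeIndices_iff.mpr ⟨⟨hi, hiD⟩, hpi⟩, rfl⟩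
    have hPjG : Pj j ∈ G := Finset.mem_image.mpr ⟨j, mem_pFreeIndices_iff.mpr ⟨⟨hj, hjD⟩, hpj⟩, rfl⟩
    have hmm : i * p ^ D ≠ j * p ^ D := fun h =>
      hij (Nat.eq_of_mul_eq_mul_right (pow_pos hp.pos D) h)
    refine hne (Pj i) hPiG (Pj j) hPjG (i * p ^ D) (j * p ^ D)
      (Nat.mul_le_mul_right _ hiD) (Nat.mul_le_mul_right _ hjD) hmm hPi0 hPj0 ?_
    -- from `v(S_i) = v(S_j)`
    have h1 : V.valuation (pRootSum p B D i) ^ p ^ D = V.valuation (pRootSum p B D j) ^ p ^ D := by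
      rw [← hvi, ← hvj, heq]
    rw [← map_pow, ← map_pow, hSpow i hi hiD, hSpow j hj hjD, map_mul, map_mul, map_pow,
      map_pow] at h1
    rw [mul_comm (V.valuation ((Pj i).eval a)), mul_comm (V.valuation ((Pj j).eval a))]
    exact h1

end NormalForm

/-! ### Prop. 4.8 unconditionally; Prop. 5.2 from `(H43)` and `(hKV)` -/

/-- **Kuhlmann 2019, Prop. 4.8 for a separably closed `K` of rank one** (characteristic `p`):
every Galois extension `E` of degree `p` of `K(z)^h`, `z` transcendental with `(K(z)|K, v)`
immediate, is `K(ϑ)^h` for some `ϑ ∈ E`. PROVED: `prop48_of_normalForm` with `(H42)` supplied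
by `lemma42_normalForm`. [cite: Kuhlmann2019, Prop. 4.8] -/
theorem prop48_sepClosed [IsAlgClosed Ω] {p : ℕ} [Fact p.Prime] [CharP Ω p]
    [CharP (ResidueField V) p] (K : Subfield Ω) [IsSepClosed K] (hr : IsRankOne V K)
    {z : Ω} (hz : Transcendental K z)
    (himm : IsImmediateOver V K (Subfield.closure ((K : Set Ω) ∪ {z})))
    {E : Subfield Ω} (hE : IsGaloisStep p (henselization V (Subfield.closure ((K : Set Ω) ∪ {z}))) E) :
    ∃ ϑ ∈ E, E = henselization V (Subfield.closure ((K : Set Ω) ∪ {ϑ})) :=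
  prop48_of_normalForm V K hr (fun _ hz' himm' f hf => lemma42_normalForm V K hz' himm' f hf)
    hz himm hE

/-- **Kuhlmann 2019, Prop. 5.2 from Lemma 4.3 (`(H43)`) and [23, Thm. 11.1] (`(hKV)`).** With
`(H42)` proved (`lemma42_normalForm`), the named fact `Kuhlmann2019_Prop52_sepClosed` follows
from the two remaining statements of `Kuhlmann2019DegreePStepAssembly.lean`: the Kummer normal
form of Lemma 4.3 in mixed characteristic and [23, Thm. 11.1] as applied.
[cite: Kuhlmann2019, Prop. 5.2] -/
theorem Kuhlmann2019_Prop52_sepClosed.of_normalForm43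
    (H43 : ∀ (Ω : Type u) [Field Ω] [IsAlgClosed Ω] (V : ValuationSubring Ω) (p : ℕ) [Fact p.Prime]
      [CharZero Ω] [CharP (ResidueField V) p] (K : Subfield Ω), IsSepClosed K → IsRankOne V K →
      ∀ (z : Ω), Transcendental K z →
      IsImmediateOver V K (Subfield.closure ((K : Set Ω) ∪ {z})) →
      ∀ f : Polynomial Ω, (∀ k, f.coeff k ∈ K) → V.valuation (f.eval z) < 1 →
      ∃ c ∈ K, ∃ d ∈ K, d ≠ 0 ∧ V.valuation ((z - c) / d) = 1 ∧
      ∃ g : Polynomial Ω, (∀ k, g.coeff k ∈ K) ∧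
        (∃ w ∈ henselization V (Subfield.closure ((K : Set Ω) ∪ {z})), w ≠ 0 ∧
          1 + f.eval z = (1 + g.eval ((z - c) / d)) * w ^ p) ∧
        (∃ i₀, 0 < i₀ ∧ ¬ p ∣ i₀ ∧ g.coeff i₀ ≠ 0 ∧
          ∀ i, 0 < i → i ≠ i₀ → V.valuation (g.coeff i) < V.valuation (g.coeff i₀)))
    (hKV : ∀ (Ω : Type u) [Field Ω] [IsAlgClosed Ω] (V : ValuationSubring Ω)
      (K F : Subfield Ω) (y : Ω), IsSepClosed K → IsRankOne V K → K ≤ F → FGOver K F →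
      SeparablyGeneratedOver K F →
      (∃ x ∈ F, Transcendental K x ∧
        ∀ z ∈ F, IsAlgebraic (IntermediateField.adjoin K ({x} : Set Ω)) z) →
      IsImmediateOver V K F → y ∈ henselization V F → Transcendental K y →
      F ≤ henselization V (Subfield.closure ((K : Set Ω) ∪ {y})) →
      ∃ y' ∈ F, Transcendental K y' ∧
        F ≤ henselization V (Subfield.closure ((K : Set Ω) ∪ {y'}))) :
    Kuhlmann2019_Prop52_sepClosed.{u} :=
  Kuhlmann2019_Prop52_sepClosed.of_normalForms
    (fun Ω _ _ V p _ _ _ K hK _ z hz himm f hf => by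
      haveI := hK
      exact lemma42_normalForm V K hz himm f hf)
    H43 hKV

end Literature.AlgebraicGeometry.Resolution

end
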